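import Literature.AlgebraicGeometry.Motives.RestrictScalarsPoints
import Literature.AlgebraicGeometry.Motives.BettiRealization
import Literature.AlgebraicTopology.SingularHomology.ClopenAdditivityCohomology
import HarnessLib

/-!
# Betti cohomology of a restriction of scalars: `Hⁱ(Z|_k(ℂ); ℚ) ≅ ∏_σ Hⁱ(Z_σ(ℂ); ℚ)`

Layer `Literature/AlgebraicGeometry/Motives`, assembling `RestrictScalarsPoints` (the complex
points of a `K`-scheme `Z` regarded over a subfield `k ⊆ K`, `[K : k] < ∞`, are the finite clopen
union over the `k`-embeddings `σ : K → ℂ` of pieces homeomorphic to `Z(ℂ)` along `σ`),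
`BaseChangePointsProofs` (`Z(ℂ)` along `σ` is homeomorphic to the complex points of the base
change `Z_σ = Z ⊗_{K,σ} ℂ`, `AlgPoints.isHomeomorph_baseChangeEquiv_holds`) and the additivity of
singular cohomology over a finite clopen partition
(`SingularHomology/ClopenAdditivityCohomology`, Hatcher 2002 §3.1 p. 202) into the decomposition
of the Betti cohomology of a restriction of scalars:

* `isClopenPartition_setOf_embOfPoint` — the pieces `{P | σ_P = σ}` form an `IsClopenPartition`
  of `Z|_k(ℂ)`;
* `AlgPoints.alongHomeomorphBaseChange Z σ : Z(ℂ)_σ ≃ₜ Z_σ(ℂ)` and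
  `pieceHomeomorphBaseChange Z σ : Z_σ(ℂ) ≃ₜ {P | σ_P = σ}`;
* **`bettiCohomologyRestrictScalarsEquiv Z i :
  Hⁱ(Z|_k(ℂ); ℚ) ≃ₗ[ℚ] ∏_{σ : K →ₐ[k] ℂ} Hⁱ(Z_σ(ℂ); ℚ)`**, componentwise the pull-back along
  `Z_σ(ℂ) ≃ₜ {P | σ_P = σ} ⊆ Z|_k(ℂ)` (`bettiCohomologyRestrictScalarsEquiv_apply`).

This is the shape of the Betti realisation of a motive over `ℚ` cut out of a variety defined over
a number field `K` (Deninger–Scholl 1991, §4.1 and 5.1: for Scholl's `X̄̄_nʷ/ℚ`,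
`H^{k-1}(X̄̄_nʷ(ℂ))` is the sum over the `φ(n)` components of `M_n ⊗ ℂ`), written for the
provefact seat of `Literature.NumberTheory.EllipticCurves.ModularForms.nonempty_schollBettiRealisation`.
Everything is proved; no named facts (D-0014).

## References

* C. Deninger, A. J. Scholl, *The Beilinson conjectures*, LMS LNS 153 (1991), §4.1, 5.1.
  [DeningerScholl1991]
* A. Hatcher, *Algebraic Topology*, CUP 2002, §3.1 p. 202. [HatcherAT2002]
* J.-P. Serre, *Géométrie algébrique et géométrie analytique* (1956), §2 (topology of complex
  points). [SerreGAGA1956]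
-/

noncomputable section

open CategoryTheory Topology

namespace Literature.AlgebraicGeometry.Motives

open Literature.AlgebraicTopology.SingularHomology

variable {k : Type} [Field k] [Algebra k ℂ] {K : Type} [Field K] [Algebra k K] (Z : SchemeOver K)

/-- The pieces `{P | σ_P = σ}` of `Z|_k(ℂ)`, `σ` running over the `k`-embeddings `K → ℂ`, form a
clopen partition when `[K : k] < ∞` (`RestrictScalarsPoints`). [folklore] -/
theorem isClopenPartition_setOf_embOfPoint [FiniteDimensional k K] :
    IsClopenPartition fun σ : K →ₐ[k] ℂ ↦
      {P : ComplexPoints (Z.restrictScalars k) | AlgPoints.embOfPoint Z P = σ} where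
  isOpen σ := AlgPoints.isOpen_setOf_embOfPoint_eq Z σ
  disjoint _ _ hne := AlgPoints.disjoint_setOf_embOfPoint_eq Z hne
  exists_mem P := ⟨AlgPoints.embOfPoint Z P, rfl⟩

/-- `Z(ℂ)`, `ℂ` a `K`-algebra through `σ`, is homeomorphic to the complex points of the base change
`Z_σ = Z ⊗_{K,σ} ℂ` (`AlgPoints.isHomeomorph_baseChangeEquiv_holds`). [folklore] -/
def AlgPoints.alongHomeomorphBaseChange (σ : K →ₐ[k] ℂ) :
    (letI := σ.toRingHom.toAlgebra; AlgPoints Z ℂ) ≃ₜ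
      ComplexPoints ((baseChangeHom σ.toRingHom).obj Z) :=
  letI := σ.toRingHom.toAlgebra
  IsHomeomorph.homeomorph (AlgPoints.baseChangeEquiv σ.toRingHom Z)
    (AlgPoints.isHomeomorph_baseChangeEquiv_holds σ.toRingHom Z)

/-- The complex points of the base change `Z_σ` are homeomorphic to the piece `{P | σ_P = σ}` of
`Z|_k(ℂ)`. [folklore] -/
def pieceHomeomorphBaseChange (σ : K →ₐ[k] ℂ) :
    ComplexPoints ((baseChangeHom σ.toRingHom).obj Z) ≃ₜ
      {P : ComplexPoints (Z.restrictScalars k) // AlgPoints.embOfPoint Z P = σ} :=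
  (AlgPoints.alongHomeomorphBaseChange Z σ).symm.trans (AlgPoints.pieceHomeomorph Z σ)

/-- The underlying point of `pieceHomeomorphBaseChange σ Q` is obtained by composing with the
projection `Z_σ → Z`. [folklore] -/
theorem pieceHomeomorphBaseChange_apply_coe_left (σ : K →ₐ[k] ℂ)
    (Q : ComplexPoints ((baseChangeHom σ.toRingHom).obj Z)) :
    ((pieceHomeomorphBaseChange Z σ Q : {P : ComplexPoints (Z.restrictScalars k) //
        AlgPoints.embOfPoint Z P = σ}) : ComplexPoints (Z.restrictScalars k)).left =
      Q.left ≫ baseChangeHomFst σ.toRingHom Z := by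
  letI := σ.toRingHom.toAlgebra
  change (AlgPoints.ofAlong Z σ ((AlgPoints.alongHomeomorphBaseChange Z σ).symm Q)).left = _
  rw [AlgPoints.ofAlong_left]
  have : (AlgPoints.alongHomeomorphBaseChange Z σ).symm Q =
      (AlgPoints.baseChangeEquiv σ.toRingHom Z).symm Q := by
    apply (AlgPoints.alongHomeomorphBaseChange Z σ).injective
    rw [Homeomorph.apply_symm_apply]
    change _ = AlgPoints.baseChangeEquiv σ.toRingHom Z ((AlgPoints.baseChangeEquiv σ.toRingHom Z).symm Q)
    rw [Equiv.apply_symm_apply]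
  rw [this]
  exact AlgPoints.baseChangeEquiv_symm_apply_left σ.toRingHom Z Q

variable [FiniteDimensional k K]

/-- **Betti cohomology of a restriction of scalars**:
`Hⁱ(Z|_k(ℂ); ℚ) ≃ₗ[ℚ] ∏_{σ : K → ℂ} Hⁱ(Z_σ(ℂ); ℚ)`, the `σ`-component being the pull-back along
`Z_σ(ℂ) ≃ₜ {P | σ_P = σ} ⊆ Z|_k(ℂ)` (additivity of singular cohomology over the finite clopen
partition by embeddings, Hatcher 2002 §3.1 p. 202; Deninger–Scholl 1991 §4.1).
[cite: HatcherAT2002, §3.1 p. 202] [cite: DeningerScholl1991, §4.1] -/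
def bettiCohomologyRestrictScalarsEquiv (i : ℕ) :
    bettiCohomology (Z.restrictScalars k) i ≃ₗ[ℚ]
      ∀ σ : K →ₐ[k] ℂ, bettiCohomology ((baseChangeHom σ.toRingHom).obj Z) i :=
  (singularCohomology.clopenPartitionPiEquiv (R := ℚ) (M := ℚ)
      (isClopenPartition_setOf_embOfPoint Z) i).trans
    (LinearEquiv.piCongrRight fun σ ↦
      (singularCohomology.mapIso (R := ℚ) (M := ℚ) (pieceHomeomorphBaseChange Z σ) i).toLinearEquiv)

/-- The `σ`-component of `bettiCohomologyRestrictScalarsEquiv z` is the pull-back of `z` along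
`Z_σ(ℂ) → Z|_k(ℂ)`. [folklore] -/
theorem bettiCohomologyRestrictScalarsEquiv_apply (i : ℕ) (z : bettiCohomology (Z.restrictScalars k) i)
    (σ : K →ₐ[k] ℂ) :
    bettiCohomologyRestrictScalarsEquiv Z i z σ =
      singularCohomology.map ℚ ℚ
        ((subsetIncl {P : ComplexPoints (Z.restrictScalars k) | AlgPoints.embOfPoint Z P = σ}).comp
          (pieceHomeomorphBaseChange Z σ : C(ComplexPoints ((baseChangeHom σ.toRingHom).obj Z),
            {P : ComplexPoints (Z.restrictScalars k) // AlgPoints.embOfPoint Z P = σ}))) i z := by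
  change (singularCohomology.mapIso (R := ℚ) (M := ℚ) (pieceHomeomorphBaseChange Z σ) i).hom
    (singularCohomology.map ℚ ℚ (subsetIncl _) i z) = _
  rw [singularCohomology.map_comp, ModuleCat.comp_apply]
  rfl

end Literature.AlgebraicGeometry.Motives

end
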